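import Summits.MatrixMultiplication.OmegaCensus.SmallFormats.MatMul22nRankGF2LowerBound
import HarnessLib

/-!
# ω-census family (a): `13n ≤ 4·R_𝔽₃(⟨2,2,n⟩)` — in particular `R_𝔽₃(⟨2,2,5⟩) ≥ 17` — by plane-cap counting

Cell `pub-omega` (unit `pub-omega-tensor-g5`), topic `Summits/MatrixMultiplication/OmegaCensus`
(sub-folder `SmallFormats`). Framing (verbatim): lottery ticket; floor = certified bounds/negative ranges.
HONEST FRAMING: the VALUES are printed ones — `R(⟨2,2,n⟩) ≥ 3n+2` over every field for `n ≥ 3` is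
Alekseev 2014/2015 (tree: the NAMED FACT `alekseev2015_rank_matMulTensor_m22_ge`, unproved here), and over
`𝔽₃` Nazarov 2023 gives `⌈36n/11⌉` (tree: NAMED FACT `nazarov2023_rank_matMulTensor_ge`). What is new for the
census is an UNCONDITIONAL kernel proof of the slightly weaker linear bound `⌈13n/4⌉` over `𝔽₃` (equal to
`3n+2` for `5 ≤ n ≤ 7`), hence of the printed floor `17 ≤ R_𝔽₃(⟨2,2,5⟩)` of the census' open rung
(`17 ≤ R_𝔽₃(⟨2,2,5⟩) ≤ 18`), which so far rested on the cited facts. Nothing here is progress on `ω`.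

THE ARGUMENT (same two lemmas as `MatMul22nRankGF2LowerBound`). Let `⟨2,2,n⟩ = ∑_{i<r} w_i ⊗ u_i ⊗ v_i` over
`𝔽₃`. (J) For each of the 32 planes of `M₂(𝔽₃)` sandwich-equivalent to the dual-number plane,
`3n + #{i : u_i ⊥ plane} ≤ r` (`JPlane.three_mul_add_card_le`, from ENG2's `three_mul_le_card`). (I) Over `𝔽₃`
a rank-one `u` annihilates exactly 2 of these planes and an invertible `u` exactly 4, i.e. `2·rank u` (a `decide`
over the 81 matrices). (S) `∑ rank u_i ≥ 4n` (`RankOneXForms.kmn_le_sum_rankBound_X`). Summing (J):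
`96n + 2·∑ rank u_i ≤ 32r`, so `104n ≤ 32r`, i.e. `13n ≤ 4r`.
-/

namespace Summit.MatrixMultiplication.OmegaCensus.SmallFormats

open Module Matrix Literature.Computability.AlgebraicComplexity

/-- Generators `M` of the 32 dual-type planes of `M₂(𝔽₃)` (`M ↦ I` under the un-sandwich). -/
def jM3 : Fin 32 → Matrix (Fin 2) (Fin 2) (ZMod 3) := ![
  Matrix.of ![![1, 0], ![0, 1]], Matrix.of ![![1, 1], ![0, 1]], Matrix.of ![![1, 2], ![0, 1]], Matrix.of ![![2, 0], ![0, 1]],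
  Matrix.of ![![2, 1], ![0, 1]], Matrix.of ![![2, 2], ![0, 1]], Matrix.of ![![0, 1], ![1, 0]], Matrix.of ![![0, 2], ![1, 0]],
  Matrix.of ![![0, 1], ![1, 0]], Matrix.of ![![0, 1], ![1, 1]], Matrix.of ![![0, 1], ![1, 2]], Matrix.of ![![0, 1], ![2, 0]],
  Matrix.of ![![0, 1], ![2, 1]], Matrix.of ![![0, 1], ![2, 2]], Matrix.of ![![1, 0], ![0, 1]], Matrix.of ![![1, 0], ![0, 2]],
  Matrix.of ![![0, 1], ![1, 1]], Matrix.of ![![0, 1], ![1, 2]], Matrix.of ![![0, 1], ![1, 0]], Matrix.of ![![0, 1], ![2, 1]],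
  Matrix.of ![![0, 1], ![2, 2]], Matrix.of ![![0, 1], ![2, 0]], Matrix.of ![![1, 0], ![1, 1]], Matrix.of ![![1, 0], ![1, 2]],
  Matrix.of ![![0, 1], ![1, 2]], Matrix.of ![![0, 1], ![1, 0]], Matrix.of ![![0, 1], ![1, 1]], Matrix.of ![![0, 1], ![2, 2]],
  Matrix.of ![![0, 1], ![2, 0]], Matrix.of ![![0, 1], ![2, 1]], Matrix.of ![![1, 0], ![2, 1]], Matrix.of ![![1, 0], ![2, 2]]]
/-- Generators `N` (`N ↦ E₀₁`). -/
def jN3 : Fin 32 → Matrix (Fin 2) (Fin 2) (ZMod 3) := ![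
  Matrix.of ![![0, 0], ![1, 0]], Matrix.of ![![0, 0], ![1, 1]], Matrix.of ![![0, 0], ![1, 2]], Matrix.of ![![0, 0], ![2, 0]],
  Matrix.of ![![0, 0], ![2, 1]], Matrix.of ![![0, 0], ![2, 2]], Matrix.of ![![0, 0], ![0, 1]], Matrix.of ![![0, 0], ![0, 2]],
  Matrix.of ![![1, 0], ![0, 0]], Matrix.of ![![1, 1], ![0, 0]], Matrix.of ![![1, 2], ![0, 0]], Matrix.of ![![2, 0], ![0, 0]],
  Matrix.of ![![2, 1], ![0, 0]], Matrix.of ![![2, 2], ![0, 0]], Matrix.of ![![0, 1], ![0, 0]], Matrix.of ![![0, 2], ![0, 0]],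
  Matrix.of ![![1, 0], ![1, 0]], Matrix.of ![![1, 1], ![1, 1]], Matrix.of ![![1, 2], ![1, 2]], Matrix.of ![![2, 0], ![2, 0]],
  Matrix.of ![![2, 1], ![2, 1]], Matrix.of ![![2, 2], ![2, 2]], Matrix.of ![![0, 1], ![0, 1]], Matrix.of ![![0, 2], ![0, 2]],
  Matrix.of ![![1, 0], ![2, 0]], Matrix.of ![![1, 1], ![2, 2]], Matrix.of ![![1, 2], ![2, 1]], Matrix.of ![![2, 0], ![1, 0]],
  Matrix.of ![![2, 1], ![1, 2]], Matrix.of ![![2, 2], ![1, 1]], Matrix.of ![![0, 1], ![0, 2]], Matrix.of ![![0, 2], ![0, 1]]]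
/-- Left un-sandwiches `P'`. -/
def jP3 : Fin 32 → Matrix (Fin 2) (Fin 2) (ZMod 3) := ![
  Matrix.of ![![0, 1], ![1, 0]], Matrix.of ![![0, 1], ![1, 0]], Matrix.of ![![0, 1], ![1, 0]], Matrix.of ![![0, 1], ![1, 0]],
  Matrix.of ![![0, 1], ![1, 0]], Matrix.of ![![0, 1], ![1, 0]], Matrix.of ![![0, 1], ![1, 0]], Matrix.of ![![0, 1], ![1, 0]],
  Matrix.of ![![1, 0], ![0, 1]], Matrix.of ![![1, 0], ![0, 1]], Matrix.of ![![1, 0], ![0, 1]], Matrix.of ![![1, 0], ![0, 1]],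
  Matrix.of ![![1, 0], ![0, 1]], Matrix.of ![![1, 0], ![0, 1]], Matrix.of ![![1, 0], ![0, 1]], Matrix.of ![![1, 0], ![0, 1]],
  Matrix.of ![![1, 0], ![2, 1]], Matrix.of ![![1, 0], ![2, 1]], Matrix.of ![![1, 0], ![2, 1]], Matrix.of ![![1, 0], ![2, 1]],
  Matrix.of ![![1, 0], ![2, 1]], Matrix.of ![![1, 0], ![2, 1]], Matrix.of ![![1, 0], ![2, 1]], Matrix.of ![![1, 0], ![2, 1]],
  Matrix.of ![![1, 0], ![1, 1]], Matrix.of ![![1, 0], ![1, 1]], Matrix.of ![![1, 0], ![1, 1]], Matrix.of ![![1, 0], ![1, 1]],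
  Matrix.of ![![1, 0], ![1, 1]], Matrix.of ![![1, 0], ![1, 1]], Matrix.of ![![1, 0], ![1, 1]], Matrix.of ![![1, 0], ![1, 1]]]
/-- Right un-sandwiches `Q'`. -/
def jQ3 : Fin 32 → Matrix (Fin 2) (Fin 2) (ZMod 3) := ![
  Matrix.of ![![0, 1], ![1, 0]], Matrix.of ![![2, 1], ![1, 0]], Matrix.of ![![1, 1], ![1, 0]], Matrix.of ![![0, 2], ![1, 0]],
  Matrix.of ![![1, 2], ![1, 0]], Matrix.of ![![2, 2], ![1, 0]], Matrix.of ![![1, 0], ![0, 1]], Matrix.of ![![1, 0], ![0, 2]],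
  Matrix.of ![![0, 1], ![1, 0]], Matrix.of ![![2, 1], ![1, 0]], Matrix.of ![![1, 1], ![1, 0]], Matrix.of ![![0, 2], ![1, 0]],
  Matrix.of ![![1, 2], ![1, 0]], Matrix.of ![![2, 2], ![1, 0]], Matrix.of ![![1, 0], ![0, 1]], Matrix.of ![![1, 0], ![0, 2]],
  Matrix.of ![![0, 1], ![1, 0]], Matrix.of ![![2, 1], ![1, 0]], Matrix.of ![![1, 1], ![1, 0]], Matrix.of ![![0, 2], ![1, 0]],
  Matrix.of ![![1, 2], ![1, 0]], Matrix.of ![![2, 2], ![1, 0]], Matrix.of ![![1, 0], ![0, 1]], Matrix.of ![![1, 0], ![0, 2]],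
  Matrix.of ![![0, 1], ![1, 0]], Matrix.of ![![2, 1], ![1, 0]], Matrix.of ![![1, 1], ![1, 0]], Matrix.of ![![0, 2], ![1, 0]],
  Matrix.of ![![1, 2], ![1, 0]], Matrix.of ![![2, 2], ![1, 0]], Matrix.of ![![1, 0], ![0, 1]], Matrix.of ![![1, 0], ![0, 2]]]

/-- The un-sandwiches take `M` to `I` (`decide`). -/
theorem jM3_ok : ∀ l : Fin 32, jP3 l * jM3 l * jQ3 l = 1 := by decide
/-- The un-sandwiches take `N` to `E₀₁` (`decide`). -/
theorem jN3_ok : ∀ l : Fin 32, jP3 l * jN3 l * jQ3 l = E01 := by decide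

/-- The 32 dual-type planes of `M₂(𝔽₃)` as `JPlane` data. -/
def jPlane3 (l : Fin 32) : JPlane (ZMod 3) := ⟨jM3 l, jN3 l, jP3 l, jQ3 l, jM3_ok l, jN3_ok l⟩

/-- The pairing `⟨A, M⟩ = ∑_b A_b M_b` over `𝔽₃`, written out. -/
def pdot3 (A : Fin 2 × Fin 2 → ZMod 3) (M : Matrix (Fin 2) (Fin 2) (ZMod 3)) : ZMod 3 :=
  A (0, 0) * M 0 0 + A (0, 1) * M 0 1 + A (1, 0) * M 1 0 + A (1, 1) * M 1 1

/-- `dotX = pdot3`. -/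
theorem dotX_eq_pdot3 (A : Fin 2 × Fin 2 → ZMod 3) (M : Matrix (Fin 2) (Fin 2) (ZMod 3)) :
    dotX A M = pdot3 A M := dotX_eq A M

/-- `A` annihilates plane `l` (Boolean test). -/
def perp3 (A : Fin 2 × Fin 2 → ZMod 3) (l : Fin 32) : Bool := decide (pdot3 A (jM3 l) = 0 ∧ pdot3 A (jN3 l) = 0)

/-- A positive `perp3` test gives the two vanishing pairings. -/
theorem perp3_dotX {A : Fin 2 × Fin 2 → ZMod 3} {l : Fin 32} (h : perp3 A l = true) :
    dotX A (jPlane3 l).M = 0 ∧ dotX A (jPlane3 l).N = 0 := by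
  rw [dotX_eq_pdot3, dotX_eq_pdot3]; exact of_decide_eq_true h

/-- `A = 0`, tested on entries. -/
def isZero43 (A : Fin 2 × Fin 2 → ZMod 3) : Bool := decide (A (0, 0) = 0 ∧ A (0, 1) = 0 ∧ A (1, 0) = 0 ∧ A (1, 1) = 0)
/-- `det A = 0`, tested on entries. -/
def det03 (A : Fin 2 × Fin 2 → ZMod 3) : Bool := decide (A (0, 0) * A (1, 1) = A (0, 1) * A (1, 0))

/-- Rank of a `2×2` matrix over `𝔽₃`: `0 / 1 / 2`. -/
def rk3 (A : Fin 2 × Fin 2 → ZMod 3) : ℕ := if isZero43 A then 0 else if det03 A then 1 else 2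

/-- (I) incidences over `𝔽₃`: `u` annihilates at least `2·rank u` of the 32 planes (exactly, in fact;
`decide` over the 81 matrices). -/
theorem two_mul_rk3_le_card_perp3 :
    ∀ A : Fin 2 × Fin 2 → ZMod 3, 2 * rk3 A ≤ (Finset.univ.filter fun l => perp3 A l = true).card :=
  forall_of_forall_mk4 (by decide)

/-- The first nonzero row of `A`. -/
def c13 (A : Fin 2 × Fin 2 → ZMod 3) (μ : Fin 2) : ZMod 3 :=
  if A (0, 0) = 0 ∧ A (0, 1) = 0 then A (1, μ) else A (0, μ)
/-- The multiple of `c13 A` that row `κ` is (for `det A = 0`). -/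
def r13 (A : Fin 2 × Fin 2 → ZMod 3) (κ : Fin 2) : ZMod 3 :=
  if A (κ, 0) = 0 ∧ A (κ, 1) = 0 then 0 else if A (κ, 0) = c13 A 0 ∧ A (κ, 1) = c13 A 1 then 1 else 2

/-- Over `𝔽₃` a matrix with `det = 0` is the outer product `r13 ⊗ c13` (`decide` over the 81 matrices). -/
theorem fac13 : ∀ A : Fin 2 × Fin 2 → ZMod 3, det03 A = true → ∀ κ μ, A (κ, μ) = r13 A κ * c13 A μ :=
  forall_of_forall_mk4 (by decide)

/-- A matrix passing `isZero43` vanishes. -/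
theorem fac03 : ∀ A : Fin 2 × Fin 2 → ZMod 3, isZero43 A = true → ∀ κ μ, A (κ, μ) = 0 :=
  forall_of_forall_mk4 (by decide)

/-- Every `A ∈ M₂(𝔽₃)` is a sum of `rk3 A` outer products. -/
theorem exists_fac3 (A : Fin 2 × Fin 2 → ZMod 3) :
    ∃ (ρ : ℕ) (r c : Fin ρ → Fin 2 → ZMod 3), ρ = rk3 A ∧ ∀ κ μ, A (κ, μ) = ∑ j, r j κ * c j μ := by
  unfold rk3
  by_cases h0 : isZero43 A = true
  · exact ⟨0, Fin.elim0, Fin.elim0, by simp [h0], fun κ μ => by simp [fac03 A h0 κ μ]⟩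
  · by_cases h1 : det03 A = true
    · exact ⟨1, fun _ => r13 A, fun _ => c13 A, by simp [h0, h1], fun κ μ => by simp [fac13 A h1 κ μ]⟩
    · refine ⟨2, fun j κ => if κ = j then 1 else 0, fun j μ => A (j, μ), by simp [h0, h1], fun κ μ => ?_⟩
      rw [Fin.sum_univ_two]
      fin_cases κ <;> simp

/-- **The counting over `𝔽₃`**: any decomposition of `⟨2,2,n⟩` over `𝔽₃` into `r` triads has `13n ≤ 4r`. -/
theorem thirteen_mul_le_four_mul_card (n r : ℕ) (w : Fin r → Fin 2 × Fin n → ZMod 3)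
    (u : Fin r → Fin 2 × Fin 2 → ZMod 3) (v : Fin r → Fin 2 × Fin n → ZMod 3)
    (hdec : matMulTensor (ZMod 3) 2 2 n = ∑ i, triad (w i) (u i) (v i)) : 13 * n ≤ 4 * r := by
  classical
  -- (S) the X-ranks sum to at least `4n`
  choose ρ rr cc hρ hfac using fun i => exists_fac3 (u i)
  have hS : 2 * 2 * n ≤ ∑ i, ρ i :=
    RankOneXForms.kmn_le_sum_rankBound_X 2 2 n w u v hdec ρ rr cc (fun i κ μ => hfac i κ μ)
  have hρw : ∑ i, ρ i = ∑ i, rk3 (u i) := Finset.sum_congr rfl fun i _ => hρ i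
  -- (J) the cap of each of the 32 planes
  have hA : ∀ i x, (bilinCompOfTriads (ZMod 3) w u v hdec).f i x = dotX (u i) x := fun i x => rfl
  have hJ : ∀ l : Fin 32, 3 * n + (Finset.univ.filter fun i => perp3 (u i) l = true).card ≤ r := by
    intro l
    have h := (jPlane3 l).three_mul_add_card_le (bilinCompOfTriads (ZMod 3) w u v hdec) u hA
      (fun i => perp3 (u i) l = true) (fun i hi => perp3_dotX hi)
    simpa only [Fintype.card_fin] using h
  have hJsum : ∑ l : Fin 32, (3 * n + (Finset.univ.filter fun i => perp3 (u i) l = true).card) ≤ ∑ _l : Fin 32, r :=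
    Finset.sum_le_sum fun l _ => hJ l
  rw [Finset.sum_add_distrib] at hJsum
  simp only [Finset.sum_const, Finset.card_univ, Fintype.card_fin, smul_eq_mul] at hJsum
  -- (I) double counting of incidences
  have hI : ∑ i, 2 * rk3 (u i) ≤ ∑ l : Fin 32, (Finset.univ.filter fun i => perp3 (u i) l = true).card := by
    calc ∑ i, 2 * rk3 (u i) ≤ ∑ i, (Finset.univ.filter fun l => perp3 (u i) l = true).card :=
          Finset.sum_le_sum fun i _ => two_mul_rk3_le_card_perp3 (u i)
      _ = ∑ l : Fin 32, (Finset.univ.filter fun i => perp3 (u i) l = true).card := by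
          simp only [Finset.card_filter]
          exact Finset.sum_comm
  rw [← Finset.mul_sum] at hI
  omega

/-- **`13n ≤ 4·R_𝔽₃(⟨2,2,n⟩)`** for every `n` (unconditional kernel bound; printed stronger bounds: `3n+2` over
every field, Alekseev 2014/2015; `⌈36n/11⌉` over `𝔽₃`, Nazarov 2023 — both only NAMED FACTS in the tree). -/
theorem thirteen_mul_le_four_mul_tensorRank_matMulTensor_22n_gf3 (n : ℕ) :
    13 * n ≤ 4 * tensorRank (matMulTensor (ZMod 3) 2 2 n) := by
  obtain ⟨w, u, v, hdec⟩ := exists_triad_decomposition_tensorRank (matMulTensor (ZMod 3) 2 2 n)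
  exact thirteen_mul_le_four_mul_card n _ w u v hdec

/-- **`17 ≤ R_𝔽₃(⟨2,2,5⟩)`**, unconditionally (the printed floor of the census' open rung; Alekseev 2014). -/
theorem seventeen_le_tensorRank_matMulTensor_225_gf3 : 17 ≤ tensorRank (matMulTensor (ZMod 3) 2 2 5) := by
  have h := thirteen_mul_le_four_mul_tensorRank_matMulTensor_22n_gf3 5
  omega

/-- **The open rung, unconditionally**: `R_𝔽₃(⟨2,2,5⟩) ∈ {17, 18}` (floor: this file; ceiling: the tree's
Hopcroft–Kerr gluing scheme). -/
theorem tensorRank_matMulTensor_225_gf3_mem : tensorRank (matMulTensor (ZMod 3) 2 2 5) ∈ Set.Icc 17 18 :=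
  ⟨seventeen_le_tensorRank_matMulTensor_225_gf3, hopcroftKerr1971_tensorRank_matMulTensor_22n_le (K := ZMod 3) 5⟩

end Summit.MatrixMultiplication.OmegaCensus.SmallFormats
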